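import Summits.ResolutionOfSingularities.ResolutionOfSingularities.Theorems.WildTwistedToricLU3
import HarnessLib

/-!
# WildTwistedToricLU (4/7) — field currency II: the two local rings `A = T_𝔪′ ⊆ B = M_𝔪′`

Node «TwistedToricCut» (decomp-res lens-1 g33), tree file 4/7.  Setting of the tree's invariant descent
(`InvariantDescentLU`): `H` a finite group of automorphisms of the field `E` (given as a `Finset` closed under `*`
containing `1`), `K` its fixed field, `O` an `H`-stable valuation ring, `M ≤ O` an `H`-stable subring generated over
constants `S ⊆ K` by a finite set `t₀`; `T := M ⊓ K`, `B := M_𝔪′ = locAtCentre M O`, `A := T_𝔪′ = locAtCentre T O`.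

* `finite_inclusion_locAtCentre_inf` — `A ⊆ B` is module-finite (norm trick + integrality of `t₀` via `charPoly`);
* `ringKrullDim_locAtCentre_inf_eq` — hence `dim A = dim B`;
* `maximalIdeal_locAtCentre_inf_eq_span` — **the structure theorem in field currency**: if `B` is regular with
  r.s.p. `x`, `σ ∈ H` has order `p = char E`, the elements of `E` fixed by `σ` lie in `K`, `σ xᵢ = xᵢ (1 + η)^{Nᵢ}`
  and `Φ ∈ B` is a principal unit with `σ Φ = Φ (1 + η)^p`, then
  `𝔪_A` is generated by the twisted monomials `x^β Φ^{−⟨β,N⟩/p}`, `β ≠ 0`, `p ∣ ⟨β,N⟩`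
  (file 2's abstract theorem instantiated on the types `↥A`, `↥B`).
-/

noncomputable section

open IsLocalRing Polynomial Literature.AlgebraicGeometry.Resolution
open Summit.ResolutionOfSingularities.ResolutionOfSingularities.Theorems.InvariantDescentLU
open Summit.ResolutionOfSingularities.ResolutionOfSingularities.Theorems.InertDescentLU
open Summit.ResolutionOfSingularities.ResolutionOfSingularities.Theorems.WildReflectionLU
open Summit.ResolutionOfSingularities.ResolutionOfSingularities.Theorems.WildLogDiagonalLU

universe u

namespace Summit.ResolutionOfSingularities.ResolutionOfSingularities.Theorems.WildTwistedToricLU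

variable {E : Type u} [Field E] (O : ValuationSubring E)

section Units

/-- Integer powers of a unit of a subring, read in the field. [folklore] -/
theorem coe_units_zpow (B : Subring E) (w : Bˣ) (n : ℤ) :
    (((w ^ n : Bˣ) : B) : E) = ((w : B) : E) ^ n := by
  have hinvE : ∀ w' : Bˣ, (((w'⁻¹ : Bˣ) : B) : E) = (((w' : B) : E))⁻¹ := fun w' => by
    refine eq_inv_of_mul_eq_one_right ?_
    rw [← Subring.coe_mul, Units.mul_inv, Subring.coe_one]
  obtain ⟨m, rfl | rfl⟩ := n.eq_nat_or_neg
  · rw [zpow_natCast, zpow_natCast, Units.val_pow_eq_pow_val, SubmonoidClass.coe_pow]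
  · rw [zpow_neg, hinvE, zpow_natCast, Units.val_pow_eq_pow_val, SubmonoidClass.coe_pow, zpow_neg,
      zpow_natCast]

/-- An element of `M_𝔪′` of value `1`, as a unit of `M_𝔪′`. [folklore] -/
def unitOfValuationEqOne (M : Subring E) {z : E} (hz : z ∈ locAtCentre M O) (hv : O.valuation z = 1) :
    (locAtCentre M O)ˣ :=
  ⟨⟨z, hz⟩, ⟨z⁻¹, inv_mem_locAtCentre hz hv⟩,
    Subtype.ext (mul_inv_cancel₀ (ne_zero_of_valuation_eq_one hv)),
    Subtype.ext (inv_mul_cancel₀ (ne_zero_of_valuation_eq_one hv))⟩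

/-- The underlying field element of `unitOfValuationEqOne`. -/
@[simp] theorem coe_unitOfValuationEqOne (M : Subring E) {z : E} (hz : z ∈ locAtCentre M O)
    (hv : O.valuation z = 1) : (((unitOfValuationEqOne O M hz hv : (locAtCentre M O)ˣ) : locAtCentre M O) : E) = z :=
  rfl

end Units

section TwoRings

variable {H : Finset (E ≃+* E)} {K : Subfield E} {M : Subring E}

/-- **`A = T_𝔪′ ⊆ B = M_𝔪′` is module-finite.**  Every `b = m/s ∈ B` is `(m·s′)·N(s)⁻¹` with `N(s) = s s′` the
norm, `N(s)⁻¹ ∈ A`; and `M = S[t₀]` with each `t ∈ t₀` integral over `T` (root of its `charPoly`), so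
`B = A[t₀]` is finite over `A`. [folklore; tree InvariantDescentLU] -/
theorem finite_inclusion_locAtCentre_inf (h1 : (1 : E ≃+* E) ∈ H) (hmul : ∀ g ∈ H, ∀ h ∈ H, g * h ∈ H)
    (hK : ∀ z, z ∈ K ↔ ∀ h ∈ H, h z = z) (hHO : ∀ h ∈ H, ∀ z : E, z ∈ O ↔ h z ∈ O)
    (hMH : ∀ h ∈ H, ∀ z ∈ M, h z ∈ M) (S : Subring E) (hSK : S ≤ K.toSubring)
    (hSM : S ≤ M) (t₀ : Finset E) (hMgen : M = Subring.closure ((S : Set E) ∪ (t₀ : Set E))) :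
    (Subring.inclusion (locAtCentre_mono O (inf_le_left : M ⊓ K.toSubring ≤ M))).Finite := by
  classical
  set T : Subring E := M ⊓ K.toSubring with hT
  have hTM : T ≤ M := inf_le_left
  set A : Subring E := locAtCentre T O with hA
  set B : Subring E := locAtCentre M O with hB
  have hAB : A ≤ B := locAtCentre_mono O hTM
  have hMB : M ≤ B := le_locAtCentre M O
  have hTA : T ≤ A := le_locAtCentre T O
  have hKfix : ∀ z ∈ K, ∀ h ∈ H, h z = z := fun z hz => (hK z).mp hz
  have ht₀M : ∀ z ∈ t₀, z ∈ M := fun z hz => by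
    rw [hMgen]; exact Subring.subset_closure (Or.inr hz)
  -- integrality of `t₀` over `A`
  have hint : ∀ z ∈ (t₀ : Set E), IsIntegral A z := by
    intro z hz
    refine isIntegral_of_monic_root A (f := charPoly H z) (fun i => hTA ?_) (charPoly_monic H z)
      (charPoly_eval_self H h1 z)
    refine Subring.mem_inf.mpr ⟨charPoly_coeff_mem H (fun h hh => hMH h hh z (ht₀M z hz)) i, ?_⟩
    exact (hK _).mpr fun h hh => apply_coeff_charPoly H hmul hh z i
  haveI hfinadj : Module.Finite A (Algebra.adjoin A (t₀ : Set E)) :=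
    Algebra.finite_adjoin_of_finite_of_isIntegral t₀.finite_toSet hint
  -- `adjoin A t₀ = B` as subsets of `E`
  have hadjB : ∀ z ∈ Algebra.adjoin A (t₀ : Set E), z ∈ B := by
    intro z hz
    let B' : Subalgebra A E :=
      { carrier := B, mul_mem' := B.mul_mem, one_mem' := B.one_mem, add_mem' := B.add_mem,
        zero_mem' := B.zero_mem, algebraMap_mem' := fun a => hAB a.2 }
    have hle : Algebra.adjoin A (t₀ : Set E) ≤ B' := Algebra.adjoin_le fun w hw => hMB (ht₀M w hw)
    exact hle hz
  have hMadj : ∀ z ∈ M, z ∈ Algebra.adjoin A (t₀ : Set E) := by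
    intro z hz
    rw [hMgen] at hz
    refine Subring.closure_le (t := (Algebra.adjoin A (t₀ : Set E)).toSubring) |>.mpr ?_ hz
    rintro w (hw | hw)
    · exact Subalgebra.algebraMap_mem (Algebra.adjoin A (t₀ : Set E)) ⟨w, hTA (Subring.mem_inf.mpr ⟨hSM hw, hSK hw⟩)⟩
    · exact Algebra.subset_adjoin hw
  have hBadj : ∀ z ∈ B, z ∈ Algebra.adjoin A (t₀ : Set E) := by
    intro z hz
    obtain ⟨m, hm, s, hs, hsv, rfl⟩ := mem_locAtCentre_iff.mp hz
    have hs0 : s ≠ 0 := ne_zero_of_valuation_eq_one hsv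
    set s' : E := ∏ h ∈ H.erase 1, h s with hs'
    set Ns : E := ∏ h ∈ H, h s with hNs
    have hNss' : s * s' = Ns := by
      rw [hs', hNs, ← Finset.mul_prod_erase H (fun h => h s) h1, RingAut.one_apply]
    have hs'M : s' ∈ M := M.prod_mem fun h hh => hMH h (Finset.mem_of_mem_erase hh) s hs
    have hNsv : O.valuation Ns = 1 := valuation_prod_eq_one O hHO hsv
    have hNs0 : Ns ≠ 0 := ne_zero_of_valuation_eq_one hNsv
    have hNsT : Ns ∈ T := by
      refine Subring.mem_inf.mpr ⟨M.prod_mem fun h hh => hMH h hh s hs, (hK _).mpr fun g hg => ?_⟩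
      exact apply_prod_eq H hmul hg s
    have hNsinvA : Ns⁻¹ ∈ A := inv_mem_locAtCentre (hTA hNsT) hNsv
    have hs'0 : s' ≠ 0 := by
      intro h; rw [h, mul_zero] at hNss'; exact hNs0 hNss'.symm
    have e : m / s = m * s' * Ns⁻¹ := by
      rw [← hNss']; field_simp
    rw [e]
    exact Subalgebra.mul_mem _ (hMadj _ (M.mul_mem hm hs'M))
      (Subalgebra.algebraMap_mem (Algebra.adjoin A (t₀ : Set E)) ⟨Ns⁻¹, hNsinvA⟩)
  -- the surjective `A`-linear map `adjoin A t₀ → B`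
  letI alg : Algebra A B := (Subring.inclusion hAB).toAlgebra
  let f : Algebra.adjoin A (t₀ : Set E) →ₗ[A] B :=
    { toFun := fun z => ⟨z, hadjB z z.2⟩
      map_add' := fun _ _ => rfl
      map_smul' := fun a z => Subtype.ext (by
        simp only [RingHom.id_apply]
        rw [Subalgebra.coe_smul, Algebra.smul_def, Algebra.smul_def]
        rfl) }
  have hf : Function.Surjective f := fun b => ⟨⟨b, hBadj b b.2⟩, Subtype.ext rfl⟩
  exact Module.Finite.of_surjective f hf

/-- `dim T_𝔪′ = dim M_𝔪′` (finite injective extensions preserve dimension). [cite: Matsumura1987, Thm. 9.4] -/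
theorem ringKrullDim_locAtCentre_inf_eq (h1 : (1 : E ≃+* E) ∈ H) (hmul : ∀ g ∈ H, ∀ h ∈ H, g * h ∈ H)
    (hK : ∀ z, z ∈ K ↔ ∀ h ∈ H, h z = z) (hHO : ∀ h ∈ H, ∀ z : E, z ∈ O ↔ h z ∈ O)
    (hMH : ∀ h ∈ H, ∀ z ∈ M, h z ∈ M) (S : Subring E) (hSK : S ≤ K.toSubring)
    (hSM : S ≤ M) (t₀ : Finset E) (hMgen : M = Subring.closure ((S : Set E) ∪ (t₀ : Set E))) :
    ringKrullDim (locAtCentre (M ⊓ K.toSubring) O) = ringKrullDim (locAtCentre M O) := by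
  have hAB : locAtCentre (M ⊓ K.toSubring) O ≤ locAtCentre M O :=
    locAtCentre_mono O (inf_le_left : M ⊓ K.toSubring ≤ M)
  letI alg : Algebra (locAtCentre (M ⊓ K.toSubring) O) (locAtCentre M O) := (Subring.inclusion hAB).toAlgebra
  haveI : Module.Finite (locAtCentre (M ⊓ K.toSubring) O) (locAtCentre M O) :=
    finite_inclusion_locAtCentre_inf O h1 hmul hK hHO hMH S hSK hSM t₀ hMgen
  haveI : Algebra.IsIntegral (locAtCentre (M ⊓ K.toSubring) O) (locAtCentre M O) :=
    Algebra.IsIntegral.of_finite _ _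
  have hinj : Function.Injective (algebraMap (locAtCentre (M ⊓ K.toSubring) O) (locAtCentre M O)) :=
    fun a b h => Subtype.ext (congrArg Subtype.val h :)
  exact (ringKrullDim_eq_of_isIntegral hinj).symm

set_option maxHeartbeats 1600000 in
/-- **THE STRUCTURE THEOREM (field currency).**  With `B = M_𝔪′` regular of dimension `d` with r.s.p. `x`,
`σ ∈ H` of order `p = char`, `σ`-fixed elements in `K`, residues represented in the constants `S ⊆ T`,
`σ xᵢ = xᵢ (1 + η)^{Nᵢ}` (`η ∈ 𝔪_B ∖ 0`) and `Φ ∈ B` a principal unit with `σ Φ = Φ (1 + η)^p`: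
the maximal ideal of `A = (M ⊓ K)_𝔪′` is generated by the twisted monomials `x^β Φ^{−⟨β,N⟩/p}` (`β ≠ 0`,
`p ∣ ⟨β,N⟩ = Σ Nⱼ βⱼ`). [this node; sources: files 1–3] -/
theorem maximalIdeal_locAtCentre_inf_eq_span (p : ℕ) [hp : Fact p.Prime] (hpE : (p : E) = 0)
    (h1 : (1 : E ≃+* E) ∈ H) (hmul : ∀ g ∈ H, ∀ h ∈ H, g * h ∈ H)
    (hK : ∀ z, z ∈ K ↔ ∀ h ∈ H, h z = z) (hHO : ∀ h ∈ H, ∀ z : E, z ∈ O ↔ h z ∈ O)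
    (hMO : M ≤ O.toSubring) (hMH : ∀ h ∈ H, ∀ z ∈ M, h z ∈ M) (hMreg : IsRegularLocalRing (locAtCentre M O))
    [IsNoetherianRing (M ⊓ K.toSubring : Subring E)]
    (S : Subring E) (hSK : S ≤ K.toSubring) (hSM : S ≤ M) (t₀ : Finset E)
    (hMgen : M = Subring.closure ((S : Set E) ∪ (t₀ : Set E)))
    (hresO : ∀ y ∈ O, ∃ c ∈ S, O.valuation (y - c) < 1)
    {σ : E ≃+* E} (hσH : σ ∈ H) (hσK : ∀ z, σ z = z → z ∈ K)
    {d : ℕ} {x : Fin d → E} (hx : ∀ i, x i ∈ locAtCentre M O ∧ O.valuation (x i) < 1)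
    (hgen : ∀ b ∈ locAtCentre M O, O.valuation b < 1 →
      ∃ c : Fin d → E, (∀ i, c i ∈ locAtCentre M O) ∧ b = ∑ i, c i * x i)
    (hdim : ringKrullDim (locAtCentre M O) = d)
    {η : E} (hη : η ∈ locAtCentre M O ∧ O.valuation η < 1) (hη0 : η ≠ 0) (N : Fin d → ℤ)
    (hσx : ∀ i, σ (x i) = x i * (1 + η) ^ N i)
    {Φ : E} (hΦB : Φ ∈ locAtCentre M O) (hΦ1 : O.valuation (Φ - 1) < 1) (hσΦ : σ Φ = Φ * (1 + η) ^ p) :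
    (haveI := isLocalRing_locAtCentre ((inf_le_left : M ⊓ K.toSubring ≤ M).trans hMO);
      maximalIdeal (locAtCentre (M ⊓ K.toSubring) O) =
        Ideal.span {a : locAtCentre (M ⊓ K.toSubring) O | ∃ β : Fin d →₀ ℕ, β ≠ 0 ∧
          (p : ℤ) ∣ pair N β ∧ (a : E) = (∏ j, x j ^ (β j)) * Φ ^ (-(pair N β / p))}) := by
  classical
  set T : Subring E := M ⊓ K.toSubring with hT
  have hTM : T ≤ M := inf_le_left
  have hTO : T ≤ O.toSubring := hTM.trans hMO
  haveI hAl : IsLocalRing (locAtCentre T O) := isLocalRing_locAtCentre hTO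
  haveI hBl : IsLocalRing (locAtCentre M O) := isLocalRing_locAtCentre hMO
  haveI hAn : IsNoetherianRing (locAtCentre T O) := isNoetherianRing_locAtCentre O hTO
  haveI : IsRegularLocalRing (locAtCentre M O) := hMreg
  haveI : IsDomain (locAtCentre M O) := inferInstance
  set A : Subring E := locAtCentre T O with hA
  set B : Subring E := locAtCentre M O with hB
  have hAB : A ≤ B := locAtCentre_mono O hTM
  have hBO : B ≤ O.toSubring := locAtCentre_le hMO
  have hTA : T ≤ A := le_locAtCentre T O
  have hKfix : ∀ z ∈ K, ∀ h ∈ H, h z = z := fun z hz => (hK z).mp hz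
  have hσO : ∀ z : E, z ∈ O ↔ σ z ∈ O := hHO σ hσH
  have hσM : ∀ z ∈ M, σ z ∈ M := hMH σ hσH
  have hσB : ∀ z ∈ B, σ z ∈ B := fun z hz => apply_mem_locAtCentre O hσO hσM hz
  -- the unit `1 + η`
  have hUv : O.valuation (1 + η) = 1 := valuation_one_add_eq_one O hη.2
  have hU0 : (1 + η) ≠ 0 := ne_zero_of_valuation_eq_one hUv
  have hUB : 1 + η ∈ B := B.add_mem B.one_mem hη.1
  have hUinv : (1 + η)⁻¹ ∈ B := inv_mem_locAtCentre hUB hUv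
  have hΦv : O.valuation Φ = 1 := by
    have := valuation_one_add_eq_one O hΦ1; rwa [add_sub_cancel] at this
  -- the algebra `A → B` and its finiteness
  letI alg : Algebra A B := (Subring.inclusion hAB).toAlgebra
  have halgE : ∀ a : A, ((algebraMap A B a : B) : E) = a := fun a => rfl
  haveI : Module.Finite A B := finite_inclusion_locAtCentre_inf O h1 hmul hK hHO hMH S hSK hSM t₀ hMgen
  have hinj : Function.Injective (algebraMap A B) := fun a b h => Subtype.ext (congrArg Subtype.val h :)
  have hdomA : ∀ a : A, a ∈ maximalIdeal A ↔ algebraMap A B a ∈ maximalIdeal B := fun a => by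
    rw [mem_maximalIdeal_locAtCentre_iff hTO, mem_maximalIdeal_locAtCentre_iff hMO]; rfl
  -- the r.s.p. in `B`
  let xB : Fin d → B := fun i => ⟨x i, (hx i).1⟩
  have hxB : Ideal.span (Set.range xB) = maximalIdeal B := by
    apply le_antisymm
    · rw [Ideal.span_le]; rintro _ ⟨i, rfl⟩
      exact (mem_maximalIdeal_locAtCentre_iff hMO _).mpr (hx i).2
    · intro b hb
      obtain ⟨c, hc, hbc⟩ := hgen b b.2 ((mem_maximalIdeal_locAtCentre_iff hMO b).mp hb)
      have : b = ∑ i, (⟨c i, hc i⟩ : B) * xB i := Subtype.ext (by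
        rw [AddSubmonoidClass.coe_finsetSum]; simpa using hbc)
      rw [this]
      exact Ideal.sum_mem _ fun i _ => Ideal.mul_mem_left _ _ (Ideal.subset_span ⟨i, rfl⟩)
  have hd : (maximalIdeal B).spanFinrank = d := by
    have h := IsRegularLocalRing.spanFinrank_maximalIdeal (R := B)
    rw [hdim] at h
    exact_mod_cast h
  -- `σ` on `B`, the units `u = 1 + η` and `Φ`
  let σB : B →+* B := σ.toRingHom.restrict B B hσB
  have hσBE : ∀ b : B, ((σB b : B) : E) = σ b := fun b => rfl
  let uB : Bˣ := unitOfValuationEqOne O M hUB hUv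
  let ΦB : Bˣ := unitOfValuationEqOne O M hΦB hΦv
  let ηB : B := ⟨η, hη.1⟩
  have hu : (uB : B) = 1 + ηB := Subtype.ext rfl
  have hηm : ηB ∈ maximalIdeal B := (mem_maximalIdeal_locAtCentre_iff hMO _).mpr hη.2
  have hηB0 : ηB ≠ 0 := fun h => hη0 (congrArg Subtype.val h)
  have hpB : (p : B) = 0 := Subtype.ext (by rw [Subring.coe_natCast]; exact hpE)
  have hΦ1B : (ΦB : B) - 1 ∈ maximalIdeal B := (mem_maximalIdeal_locAtCentre_iff hMO _).mpr hΦ1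
  have hσxB : ∀ j, σB (xB j) = xB j * ((uB ^ N j : Bˣ) : B) := fun j => Subtype.ext (by
    rw [Subring.coe_mul, coe_units_zpow]; exact hσx j)
  have hσΦB : σB (ΦB : B) = (ΦB : B) * ((uB ^ (p : ℤ) : Bˣ) : B) := Subtype.ext (by
    rw [Subring.coe_mul, coe_units_zpow, zpow_natCast]; exact hσΦ)
  -- residues and the derivation
  have hresB : ∀ b ∈ B, ∃ c ∈ B, σ c = c ∧ O.valuation (b - c) < 1 := by
    intro b hb
    obtain ⟨c, hcS, hc⟩ := hresO b (hBO hb)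
    exact ⟨c, le_locAtCentre M O (hSM hcS), hKfix c (hSK hcS) σ hσH, hc⟩
  have hD : ∀ b : B, ∃ m ∈ maximalIdeal B, σB b - b = ηB * m := by
    intro b
    obtain ⟨m, hmB, hmv, hm⟩ := exists_apply_sub_eq_eta_mul O hMO hσO hσM hresB hx hgen hη.1 hU0 hUinv N hσx b.2
    exact ⟨⟨m, hmB⟩, (mem_maximalIdeal_locAtCentre_iff hMO _).mpr hmv, Subtype.ext hm⟩
  have hAfix : ∀ a : A, σB (algebraMap A B a) = algebraMap A B a := by
    intro a
    apply Subtype.ext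
    rw [hσBE, halgE]
    obtain ⟨y, hy, z, hz, -, hyz⟩ := mem_locAtCentre_iff.mp a.2
    rw [hyz, map_div₀, hKfix y (Subring.mem_inf.mp hy).2 σ hσH, hKfix z (Subring.mem_inf.mp hz).2 σ hσH]
  have hfix : ∀ b : B, σB b = b → ∃ a : A, algebraMap A B a = b := by
    intro b hb
    have hbE : σ (b : E) = b := by rw [← hσBE, hb]
    have hbA : (b : E) ∈ A :=
      mem_locAtCentre_inf_of_fixed O h1 hmul hK hMO hMH b.2 fun h hh => hKfix _ (hσK _ hbE) h hh
    exact ⟨⟨b, hbA⟩, Subtype.ext rfl⟩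
  have hres : ∀ b : B, ∃ a : A, b - algebraMap A B a ∈ maximalIdeal B := by
    intro b
    obtain ⟨c, hcS, hc⟩ := hresO b (hBO b.2)
    refine ⟨⟨c, hTA (Subring.mem_inf.mpr ⟨hSM hcS, hSK hcS⟩)⟩, (mem_maximalIdeal_locAtCentre_iff hMO _).mpr ?_⟩
    exact hc
  -- the abstract structure theorem
  have hmain := maximalIdeal_eq_span_twMono hinj hdomA hd xB hxB σB uB ΦB N hp.out hpB ηB hu hηm hηB0 hΦ1B
    hσxB hσΦB hD hAfix hfix hres
  rw [hmain]
  congr 1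
  ext a
  simp only [Set.mem_setOf_eq]
  refine exists_congr fun β => and_congr_right fun _ => and_congr_right fun _ => ?_
  rw [show (algebraMap A B a = twMono xB ΦB N p β) ↔ ((algebraMap A B a : B) : E) = (twMono xB ΦB N p β : B)
    from ⟨fun h => congrArg Subtype.val h, fun h => Subtype.ext h⟩, halgE]
  simp only [twMono, mono, Subring.coe_mul, SubmonoidClass.coe_finsetProd, SubmonoidClass.coe_pow,
    coe_units_zpow]
  exact Iff.rfl

end TwoRings

end Summit.ResolutionOfSingularities.ResolutionOfSingularities.Theorems.WildTwistedToricLU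

end
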